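import Mathlib
import Summits.ResolutionOfSingularities.ResolutionOfSingularities.Theorems.SyzygyFlatteningDefs
import HarnessLib

/-!
# `stub_minGenerators` — a minimal generating family of the maximal ideal with a member of
maximal valuation

Stub `stub_minGenerators` of the crux `RankOneTermination` (crux
stmt-ResolutionOfSingularities-17044, line `birth`). Pure commutative algebra: for a Noetherian
local `k`-subalgebra `B ⊆ K` whose maximal ideal `𝔪` has `spanFinrank 𝔪 = e + 1`, and a
valuation subring `O ⊆ K` with valuation `v = O.valuation`, there is a family `x₀, …, x_e` of
elements of `B` with

* `𝔪 = (x₀, …, x_e)`;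
* minimality: every linear relation `∑ sᵢ xᵢ = 0` has all its coefficients `sᵢ` in `𝔪`;
* `v(xᵢ) ≤ v(x₀)` for all `i` (`x₀` has the largest valuation, i.e. the smallest order).

Proof. A generating set of `𝔪` of cardinality `spanFinrank 𝔪 = e + 1` exists
(`Submodule.FG.exists_span_finset_card_eq_spanFinrank`); index it by `Fin (e + 1)` and permute
the indices so that index `0` carries a member of maximal valuation (`Finite.exists_max`,
`Equiv.swap`). Minimality: if `∑ sᵢ xᵢ = 0` with `s_j ∉ 𝔪`, then `s_j` is a unit, so `x_j` is a
combination of the other `e` members of the family, whence `𝔪` is generated by `e` elements and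
`spanFinrank 𝔪 ≤ e` (`Submodule.spanFinrank_span_le_ncard_of_finite`), a contradiction.
-/

noncomputable section

-- single-problem summit: the doubled namespace component `ResolutionOfSingularities` is forced
set_option linter.dupNamespace false

namespace Summit.ResolutionOfSingularities.ResolutionOfSingularities.Theorems.SyzygyFlattening

/-! ## Generating families indexed by `Fin n` -/

/-- The span rank of the ideal generated by a `Fin n`-indexed family is at most `n`.
[folklore] -/
theorem minGen_spanFinrank_span_range_le {R : Type*} [CommRing R] {n : ℕ} (x : Fin n → R) :
    (Ideal.span (Set.range x)).spanFinrank ≤ n := by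
  classical
  refine (Submodule.spanFinrank_span_le_ncard_of_finite (Set.finite_range x)).trans ?_
  rw [← Fintype.coe_image_univ, Set.ncard_coe_finset]
  exact Finset.card_image_le.trans (by simp)

/-- A finitely generated ideal `I` with `spanFinrank I = n` is generated by a `Fin n`-indexed
family. [folklore] -/
theorem minGen_exists_fin_span_eq {R : Type*} [CommRing R] {I : Ideal R}
    (hI : Submodule.FG I) {n : ℕ} (hn : I.spanFinrank = n) :
    ∃ y : Fin n → R, Ideal.span (Set.range y) = I := by
  obtain ⟨s, hs, hspan⟩ := Submodule.FG.exists_span_finset_card_eq_spanFinrank hI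
  rw [hn] at hs
  refine ⟨fun i => ((Finset.equivFinOfCardEq hs).symm i : R), ?_⟩
  have hrange :
      Set.range (fun i => ((Finset.equivFinOfCardEq hs).symm i : R)) = (s : Set R) := by
    ext r
    simp only [Set.mem_range, Finset.mem_coe]
    constructor
    · rintro ⟨i, rfl⟩
      exact Finset.coe_mem _
    · intro hr
      exact ⟨Finset.equivFinOfCardEq hs ⟨r, hr⟩, by simp⟩
  rw [hrange]
  exact hspan

/-! ## Minimality of a generating family of cardinality `spanFinrank` -/

/-- If `x : Fin (e + 1) → R` generates the maximal ideal `𝔪` of a local ring with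
`spanFinrank 𝔪 = e + 1`, then every relation `∑ sᵢ xᵢ = 0` has all `sᵢ ∈ 𝔪`: otherwise some
`s_j` is a unit, `x_j` is a combination of the other members of the family, and `𝔪` is
generated by `e` elements. [folklore] -/
theorem minGen_mem_maximalIdeal_of_sum_mul_eq_zero {R : Type*} [CommRing R] [IsLocalRing R]
    {e : ℕ} (he : (IsLocalRing.maximalIdeal R).spanFinrank = e + 1) (x : Fin (e + 1) → R)
    (hx : Ideal.span (Set.range x) = IsLocalRing.maximalIdeal R) (s : Fin (e + 1) → R)
    (hs : ∑ i, s i * x i = 0) (j : Fin (e + 1)) : s j ∈ IsLocalRing.maximalIdeal R := by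
  by_contra hj
  have hu : IsUnit (s j) := IsLocalRing.notMem_maximalIdeal.mp hj
  have hxj : x j ∈ Ideal.span (Set.range (x ∘ j.succAbove)) := by
    have h1 : s j * x j = -∑ i : Fin e, s (j.succAbove i) * x (j.succAbove i) := by
      rw [Fin.sum_univ_succAbove _ j] at hs
      linear_combination hs
    obtain ⟨t, ht⟩ := hu.exists_left_inv
    have h2 : x j = t * (s j * x j) := by rw [← mul_assoc, ht, one_mul]
    rw [h2, h1]
    exact Ideal.mul_mem_left _ _ (neg_mem (Ideal.sum_mem _ fun i _ =>
      Ideal.mul_mem_left _ _ (Ideal.subset_span ⟨i, rfl⟩)))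
  have hle : IsLocalRing.maximalIdeal R ≤ Ideal.span (Set.range (x ∘ j.succAbove)) := by
    rw [← hx, Ideal.span_le]
    rintro _ ⟨i, rfl⟩
    rcases Fin.eq_self_or_eq_succAbove j i with rfl | ⟨i', rfl⟩
    · exact hxj
    · exact Ideal.subset_span ⟨i', rfl⟩
  have hge : Ideal.span (Set.range (x ∘ j.succAbove)) ≤ IsLocalRing.maximalIdeal R := by
    rw [← hx]
    exact Ideal.span_mono (Set.range_comp_subset_range _ _)
  have hrk : (IsLocalRing.maximalIdeal R).spanFinrank ≤ e := by
    rw [le_antisymm hle hge]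
    exact minGen_spanFinrank_span_range_le _
  omega

/-! ## The stub -/

/-- **STUB `stub_minGenerators`** (pure commutative algebra). For a Noetherian local
`k`-subalgebra `B ⊆ K` with `spanFinrank 𝔪_B = e + 1` and a valuation subring `O ⊆ K`, there
is a generating family `x₀, …, x_e` of `𝔪_B` which is minimal (every relation `∑ sᵢ xᵢ = 0`
has all `sᵢ ∈ 𝔪_B`, since `𝔪_B` cannot be generated by `e` elements) and is ordered so that
`x₀` has the largest `O`-valuation (a generating set of cardinality `spanFinrank`, indexed by
`Fin (e + 1)` and permuted by a transposition putting a member of maximal valuation first).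
[folklore] -/
theorem stub_minGenerators : ∀ (k K : Type) [Field k] [Field K] [Algebra k K]
    (O : ValuationSubring K) (B : Subalgebra k K) [IsLocalRing ↥B] [IsNoetherianRing ↥B] (e : ℕ),
      (IsLocalRing.maximalIdeal ↥B).spanFinrank = e + 1 →
      ∃ x : Fin (e + 1) → ↥B,
        Ideal.span (Set.range x) = IsLocalRing.maximalIdeal ↥B ∧
        (∀ s : Fin (e + 1) → ↥B, ∑ i, s i * x i = 0 → ∀ i, s i ∈ IsLocalRing.maximalIdeal ↥B) ∧
        (∀ i, O.valuation ((x i : ↥B) : K) ≤ O.valuation ((x 0 : ↥B) : K)) := by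
  intro k K _ _ _ O B _ _ e he
  obtain ⟨y, hy⟩ := minGen_exists_fin_span_eq (IsNoetherian.noetherian _) he
  obtain ⟨i₀, hi₀⟩ := Finite.exists_max fun i => O.valuation ((y i : ↥B) : K)
  have hx : Ideal.span (Set.range (y ∘ Equiv.swap 0 i₀)) = IsLocalRing.maximalIdeal ↥B := by
    rw [(Equiv.swap 0 i₀).surjective.range_comp]
    exact hy
  refine ⟨y ∘ Equiv.swap 0 i₀, hx,
    fun s hs i => minGen_mem_maximalIdeal_of_sum_mul_eq_zero he _ hx s hs i, fun i => ?_⟩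
  simp only [Function.comp_apply, Equiv.swap_apply_left]
  exact hi₀ _

end Summit.ResolutionOfSingularities.ResolutionOfSingularities.Theorems.SyzygyFlattening

end
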